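import Mathlib.Analysis.SpecialFunctions.Pow.Asymptotics
import Literature.Probability.LatticeModels.IsoradialPercolation
import Literature.Probability.LatticeModels.ThermodynamicLimit
import Literature.Probability.Percolation.MeanFieldBetaFromGamma
import Literature.Probability.LatticeModels.ProdBernoulliIndependence
import HarnessLib

/-!
# Long-range percolation on `ℤ^d` with a kernel `J` (Hutchcroft's parametrisation), and the
critical two-point / volume-tail bounds of Hutchcroft 2022 (named fact) with continuity at `β_c` (proved)

Topic `Literature/Probability/Percolation`, family `crit-ising`/`crit-perc`. Consumer: the route
`Summits/CriticalPhenomena/PercolationContinuityZ3/Theses/PercLongRangeCatalyst` (cruxes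
`UniformCatalystVolumeTail`, `UniformCatalystTwoPoint`), which inlines the `d = 3` mixed kernel
`J_{λ,α}(x,y) = 1{x ∼ y} + λ‖x−y‖_∞^{−3−α}` through `prodBernoulli` on `Sym2 (Site 3)` in exactly
the shape `kernelPercolation J b` below (`kernelPercolation_eq`). Sources read, verbatim:

* T. Hutchcroft, *Sharp hierarchical upper bounds on the critical two-point function for
  long-range percolation on `ℤ^d`*, J. Math. Phys. 63 (2022) = arXiv:2202.07634, §1 (arXiv p. 3):
  "Let `d ≥ 1` and let `J : ℤ^d × ℤ^d → [0,∞)` be a kernel that is symmetric in the sense that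
  `J(x,y) = J(y,x)` for every `x, y ∈ ℤ^d`. For each `β ≥ 0`, long-range percolation on `ℤ^d` with
  kernel `J` is the random graph with vertex set `ℤ^d` in which each potential edge `{x,y}` is
  included independently at random with probability `1 − exp(−βJ(x,y))`. We write `ℙ_β = ℙ_{β,J}`
  for the law of the resulting random graph. We will be particularly interested in the case that
  `J` is translation-invariant, meaning that `J(x,y) = J(0,y−x)` for every `x, y ∈ ℤ^d` and
  integrable, meaning that `Σ_{y ∈ ℤ^d} J(x,y) < ∞` for every `x`. […]
  `β_c = β_c(J) := inf{β ≥ 0 : ℙ_β(an infinite cluster exists) > 0}`, which satisfies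
  `0 < β_c < ∞` if `d ≥ 2` and `α > 0` or `d = 1` and `0 < α ≤ 1` […] Noam Berger proved in 2002
  that the phase transition is continuous in the sense that there are no infinite clusters at `β_c`
  whenever `0 < α < d`". (p. 4:) "We write `Λ_r = [−r,r]^d ∩ ℤ^d` for each `r ≥ 1` and write
  `‖·‖ = ‖·‖_∞`. **Theorem 1.1.** Let `d ≥ 1`, let `J : ℤ^d × ℤ^d → [0,∞)` be a symmetric,
  integrable, translation-invariant kernel, and suppose that there exist constants `0 < α < d` and
  `c > 0` such that `J(x,y) ≥ c‖x−y‖^{−d−α}` for all distinct `x, y ∈ ℤ^d`. Then there exists a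
  constant `A = A(d,α)` such that `(1/|Λ_r|) Σ_{x ∈ Λ_r} ℙ_{β_c}(0 ↔ x) ≤ (A/(cβ_c)) r^{−d+α}` for
  every `r ≥ 1`." (p. 5:) "**Corollary 1.4.** [same hypotheses] Then there exists a constant
  `A = A(d,α)` such that `ℙ_{β_c}(|K| ≥ n) ≤ (A/(cβ_c)^{d/(2d−α)}) n^{−(d−α)/2d}` for every
  `n ≥ 1`." (Proofs, arXiv pp. 13–14: both bounds are first proved "for every `0 < β < β_c`" with
  `β` in place of `β_c`, then passed to `β_c` by left-continuity / monotone convergence.)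
* N. Berger, *Transience, recurrence and critical behavior for long-range percolation*,
  Comm. Math. Phys. 226 (2002) = arXiv:math/0110296, Thm. 1.5 (arXiv p. 3): "Let `d ≥ 1` and let
  `{P_k}_{k ∈ ℤ^d}` be probabilities such that `P_k ∼ β‖k‖₁^{−s}`. Assume that `d < s < 2d`. Then,
  if `{P_k}` is percolating then it is not critical, i.e. there exists an `ε > 0` such that the
  sequence `{P'_k = (1−ε)P_k}` is also percolating."

## Content

* Definitions (real): a kernel is a function `J : Sym2 (Site d) → ℝ` (symmetric by construction;
  `Site d = Fin d → ℤ` with Mathlib's sup metric `dist` = Hutchcroft's `‖·‖_∞`);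
  `IsTranslationInvariantKernel`, `IsIntegrableKernel`, `HasPowerLowerBound J c α`
  (`J(x,y) ≥ c‖x−y‖^{−d−α}` for `x ≠ y`); the edge probabilities
  `kernelEdgeProb J β e = 1 − exp(−β J e)` (clamped into `[0,1]` by `Set.projIcc`, a no-op for
  `β J e ≥ 0`); the law `kernelPercolation J β := prodBernoulli (kernelEdgeProb J β)` on bond
  configurations of the complete graph on `ℤ^d` (`BondConfig (Site d)`; every pair is a potential
  edge); the percolation probability `kernelTheta J β = ℙ_β(|K(0)| = ∞)`; and
  `kernelCriticalBeta J = inf{β ≥ 0 : ℙ_β(an infinite cluster exists) > 0}` (junk `0` if the set is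
  empty, which does not happen under the hypotheses below).
* ONE named fact (D-0014), in the printed/proved scope `0 < β ≤ β_c`:
  `Hutchcroft2022_twoPoint_volumeTail` — Thm. 1.1 ∧ Cor. 1.4 with one constant `A = A(d,α)` (the
  maximum of the two printed ones) and `β` in place of `β_c` in the constants: printed at `β_c`
  ("`(1/|Λ_r|) Σ_{x∈Λ_r} ℙ_{β_c}(0↔x) ≤ (A/(cβ_c)) r^{−d+α}`", "`ℙ_{β_c}(|K| ≥ n) ≤
  (A/(cβ_c)^{d/(2d−α)}) n^{−(d−α)/2d}`"), and established in the printed proofs "for every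
  `0 < β < β_c`" with `β` in the constants (arXiv pp. 13–14) before passing to `β_c`.
* PROVED from it: the projections `.twoPoint`, `.volumeTail`, `.at_kernelCriticalBeta`
  (the printed `β_c` form, given `0 < β_c`); `kernelTheta_zero` (`θ_J(0) = 0`: at `β = 0` no edge
  is open, by the one-edge marginals of `prodBernoulli`); and **continuity at `β_c`**,
  `Hutchcroft2022_twoPoint_volumeTail.kernelTheta_kernelCriticalBeta_eq_zero`:
  `θ_J(β_c) = 0` — Berger's theorem ("no infinite clusters at `β_c` whenever `0 < α < d`", Berger
  2002 Thm. 1.5 for kernels `P_k ∼ β‖k‖₁^{−s}`, `d < s < 2d`) in Hutchcroft's class of kernels,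
  where it follows from Cor. 1.4 at `β_c` (`θ ≤ ℙ_{β_c}(|K| ≥ n) ≤ C n^{−(d−α)/2d} → 0`; the Lean
  junk case `β_c = 0` is `θ_J(0) = 0`).
* The route consumes the bounds for "non-percolating `b > 0`" (`θ_J(b) = 0`); that shape follows
  from the fact through `θ_J(β) = 0 ∧ 0 < β ⇒ β ≤ β_c` (translation invariance: `θ` is the same at
  every vertex, so an infinite cluster somewhere with positive probability gives `θ > 0`; plus
  `β_c < ∞`), a bridge NOT proved here (it needs the shift invariance of `kernelPercolation` and
  `0 < β_c < ∞`, Schulman 1983 / Newman–Schulman 1986).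

Not here: the discharge (XL), `0 < β_c < ∞` (Schulman 1983 / Newman–Schulman 1986), the bridge
`θ_J(β) = 0 ⇒ β ≤ β_c`, the mixed "catalyst" kernel of the route and the verification of its
hypotheses (integrability of `‖y‖_∞^{−d−α}` over `ℤ^d`).

## References

* [Hutchcroft2022] T. Hutchcroft, J. Math. Phys. 63 (2022), doi:10.1063/5.0088450 =
  arXiv:2202.07634: §1, Thm. 1.1 (p. 4), Cor. 1.4 (p. 5), proofs pp. 13–14.
* [Berger2002] N. Berger, Comm. Math. Phys. 226 (2002) 531–558 = arXiv:math/0110296, Thm. 1.5.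
-/

noncomputable section

namespace Literature.Probability.Percolation

open _root_.MeasureTheory
open Literature.Probability.LatticeModels

variable {d : ℕ}

/-! ### Kernels on `ℤ^d` -/

/-- `J` is **translation-invariant**: "`J(x,y) = J(0,y−x)` for every `x, y`", equivalently
`J(x+t, y+t) = J(x,y)`. (A kernel is a function on unordered pairs `Sym2 (Site d)`, hence
symmetric.) [cite: Hutchcroft2022, §1 (p. 3)] -/
def IsTranslationInvariantKernel (J : Sym2 (Site d) → ℝ) : Prop :=
  ∀ x y t : Site d, J s(x + t, y + t) = J s(x, y)

/-- `J` is **integrable**: "`Σ_{y ∈ ℤ^d} J(x,y) < ∞` for every `x`". [cite: Hutchcroft2022, §1 (p. 3)] -/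
def IsIntegrableKernel (J : Sym2 (Site d) → ℝ) : Prop :=
  ∀ x : Site d, Summable fun y : Site d => J s(x, y)

/-- **Power-law lower bound**: "`J(x,y) ≥ c‖x−y‖^{−d−α}` for all distinct `x, y ∈ ℤ^d`", with
`‖·‖ = ‖·‖_∞` (Mathlib's sup metric `dist` on `Site d = Fin d → ℤ`). [cite: Hutchcroft2022, Thm. 1.1 (p. 4)] -/
def HasPowerLowerBound (J : Sym2 (Site d) → ℝ) (c α : ℝ) : Prop :=
  ∀ x y : Site d, x ≠ y → c * (dist x y) ^ (-((d : ℝ) + α)) ≤ J s(x, y)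

/-! ### The model `ℙ_{β,J}` -/

/-- Edge probabilities `ℙ_β({x,y} open) = 1 − exp(−β J(x,y))` (clamped into `[0,1]` by
`Set.projIcc`; for `β J ≥ 0` the clamp is the identity). [cite: Hutchcroft2022, §1 (p. 3)] -/
def kernelEdgeProb (J : Sym2 (Site d) → ℝ) (β : ℝ) (e : Sym2 (Site d)) : unitInterval :=
  Set.projIcc (0 : ℝ) 1 zero_le_one (1 - Real.exp (-(β * J e)))

/-- **Long-range percolation on `ℤ^d` with kernel `J` at parameter `β`**, `ℙ_{β,J}`: each potential
edge `{x,y}` (every unordered pair of `ℤ^d`) is open independently with probability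
`1 − exp(−β J(x,y))` — the product Bernoulli measure `prodBernoulli (kernelEdgeProb J β)` on bond
configurations `BondConfig (Site d) = Set (Sym2 (Site d))`. [cite: Hutchcroft2022, §1 (p. 3)] -/
def kernelPercolation (J : Sym2 (Site d) → ℝ) (β : ℝ) : Measure (BondConfig (Site d)) :=
  prodBernoulli (kernelEdgeProb J β)

/-- Unfolding to the route's inline shape: `ℙ_{β,J} = prodBernoulli (e ↦ projIcc 0 1 (1 − e^{−β J e}))`.
[cite: Hutchcroft2022, §1 (p. 3)] -/
theorem kernelPercolation_eq (J : Sym2 (Site d) → ℝ) (β : ℝ) :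
    kernelPercolation J β =
      prodBernoulli fun e : Sym2 (Site d) =>
        Set.projIcc (0 : ℝ) 1 zero_le_one (1 - Real.exp (-(β * J e))) :=
  rfl

/-- `ℙ_{β,J}` is a probability measure. [folklore] -/
instance instIsProbabilityMeasureKernelPercolation (J : Sym2 (Site d) → ℝ) (β : ℝ) :
    IsProbabilityMeasure (kernelPercolation J β) := by
  unfold kernelPercolation; infer_instance

/-- At `β = 0` every edge probability is `1 − e⁰ = 0`. [cite: Hutchcroft2022, §1 (p. 3)] -/
@[simp]
theorem kernelEdgeProb_zero (J : Sym2 (Site d) → ℝ) (e : Sym2 (Site d)) :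
    kernelEdgeProb J 0 e = 0 := by
  ext
  simp [kernelEdgeProb, Set.projIcc]

/-- The **percolation probability** `θ_J(β) = ℙ_{β,J}(|K(0)| = ∞)` of the origin.
[cite: Hutchcroft2022, §1 (p. 3)] -/
def kernelTheta (J : Sym2 (Site d) → ℝ) (β : ℝ) : ℝ :=
  (kernelPercolation J β).real (percolatesAt (0 : Site d))

/-- Unfolding of `θ_J(β)` to the route's inline shape. [cite: Hutchcroft2022, §1 (p. 3)] -/
theorem kernelTheta_eq (J : Sym2 (Site d) → ℝ) (β : ℝ) :
    kernelTheta J β =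
      (prodBernoulli fun e : Sym2 (Site d) =>
          Set.projIcc (0 : ℝ) 1 zero_le_one (1 - Real.exp (-(β * J e)))).real
        (percolatesAt (0 : Site d)) :=
  rfl

/-- The **critical parameter** "`β_c(J) := inf{β ≥ 0 : ℙ_β(an infinite cluster exists) > 0}`"
(junk value `0 = sInf ∅` when no `β` percolates). [cite: Hutchcroft2022, §1 (p. 3)] -/
def kernelCriticalBeta (J : Sym2 (Site d) → ℝ) : ℝ :=
  sInf {β : ℝ | 0 ≤ β ∧ 0 < (kernelPercolation J β).real {ω | ∃ x : Site d, ω ∈ percolatesAt x}}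

/-- `β_c(J) ≥ 0`. [cite: Hutchcroft2022, §1 (p. 3)] -/
theorem kernelCriticalBeta_nonneg (J : Sym2 (Site d) → ℝ) : 0 ≤ kernelCriticalBeta J :=
  Real.sInf_nonneg fun _ hβ => hβ.1

/-! ### `θ_J(0) = 0` -/

/-- An infinite open cluster at `0` uses an open edge at `0`. [folklore] -/
theorem percolatesAt_zero_subset_iUnion :
    percolatesAt (0 : Site d) ⊆ ⋃ y : Site d, {ω : BondConfig (Site d) | s((0 : Site d), y) ∈ ω} := by
  intro ω hω
  obtain ⟨y, hy, hy0⟩ := Set.Infinite.exists_notMem_finset hω {(0 : Site d)}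
  rw [Finset.mem_singleton] at hy0
  obtain ⟨p⟩ := hy
  cases p with
  | nil => exact absurd rfl hy0
  | cons hadj _ =>
    rw [openGraph_adj] at hadj
    exact Set.mem_iUnion.2 ⟨_, hadj.1⟩

/-- **`θ_J(0) = 0`**: at `β = 0` every edge is open with probability `1 − e⁰ = 0`, so almost surely
no edge at the origin is open and its cluster is `{0}`. [cite: Hutchcroft2022, §1 (p. 3)] -/
theorem kernelTheta_zero (J : Sym2 (Site d) → ℝ) : kernelTheta J 0 = 0 := by
  have hnull : ∀ y : Site d,
      kernelPercolation J 0 {ω : BondConfig (Site d) | s((0 : Site d), y) ∈ ω} = 0 := by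
    intro y
    have h := prodBernoulli_real_setOf_mem (kernelEdgeProb J 0) s((0 : Site d), y)
    rw [kernelEdgeProb_zero] at h
    have h' : (kernelPercolation J 0).real {ω : BondConfig (Site d) | s((0 : Site d), y) ∈ ω} = 0 := by
      simpa [kernelPercolation] using h
    exact (measureReal_eq_zero_iff (measure_ne_top _ _)).mp h'
  rw [kernelTheta, measureReal_def,
    measure_mono_null percolatesAt_zero_subset_iUnion (measure_iUnion_null hnull),
    ENNReal.toReal_zero]

/-! ### The named fact -/

/-- **Hutchcroft 2022, Thm. 1.1 and Cor. 1.4** (named fact, D-0014). For `d ≥ 1` and `0 < α < d`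
there is `A = A(d,α)` such that for every symmetric, nonnegative, translation-invariant,
integrable kernel `J` on `ℤ^d` with `J(x,y) ≥ c‖x−y‖_∞^{−d−α}` (`x ≠ y`, `c > 0`) and every
`0 < β ≤ β_c(J)`: (two-point) `(1/|Λ_r|) Σ_{x ∈ Λ_r} ℙ_β(0 ↔ x) ≤ (A/(cβ)) r^{−d+α}` for all `r ≥ 1`
(`Λ_r = box d r = [−r,r]^d ∩ ℤ^d`), and (volume tail)
`ℙ_β(|K(0)| ≥ n) ≤ (A/(cβ)^{d/(2d−α)}) n^{−(d−α)/(2d)}` for all `n ≥ 1`. Printed at `β = β_c`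
("`(1/|Λ_r|) Σ_{x∈Λ_r} ℙ_{β_c}(0↔x) ≤ (A/(cβ_c)) r^{−d+α}`"; "`ℙ_{β_c}(|K| ≥ n) ≤
(A/(cβ_c)^{d/(2d−α)}) n^{−(d−α)/2d}`") and proved first "for every `0 < β < β_c`" with `β` in the
constants (pp. 13–14: "`Σ_{a ∈ Λ_r} ℙ_β(0↔a) ≤ (A₂/(cβ)) r^α` for every `0 < β < β_c` and `r ≥ 1`";
"`ℙ_β(|K| ≥ n) ≤ C₆ (cβ)^{−d/(2d−α)} n^{−θ}` for every `0 < β < β_c` and `n ≥ 1`, and hence also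
for `β = β_c`"), which is the scope stated here.
[cite: Hutchcroft2022, Thm. 1.1 (p. 4) and Cor. 1.4 (p. 5); proofs pp. 13–14] -/
def Hutchcroft2022_twoPoint_volumeTail : Prop :=
  ∀ (d : ℕ), 1 ≤ d → ∀ α : ℝ, 0 < α → α < d → ∃ A : ℝ, 0 < A ∧
    ∀ (J : Sym2 (Site d) → ℝ) (c : ℝ), 0 < c → (∀ e, 0 ≤ J e) →
      IsTranslationInvariantKernel J → IsIntegrableKernel J → HasPowerLowerBound J c α →
      ∀ β : ℝ, 0 < β → β ≤ kernelCriticalBeta J →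
        (∀ r : ℕ, 1 ≤ r →
          (∑ x ∈ box d r, (kernelPercolation J β).real (openConn (0 : Site d) x)) /
              ((box d r).card : ℝ) ≤ A / (c * β) * (r : ℝ) ^ (-(d : ℝ) + α)) ∧
        (∀ n : ℕ, 1 ≤ n →
          (kernelPercolation J β).real (clusterSizeGe (0 : Site d) n) ≤
            A / (c * β) ^ ((d : ℝ) / (2 * d - α)) * (n : ℝ) ^ (-((d : ℝ) - α) / (2 * d)))

namespace Hutchcroft2022_twoPoint_volumeTail

/-- **Thm. 1.1 alone** (the two-point bound on `(0, β_c]`), projected from the fact.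
[cite: Hutchcroft2022, Thm. 1.1 (p. 4)] -/
theorem twoPoint (h : Hutchcroft2022_twoPoint_volumeTail) {d : ℕ} (hd : 1 ≤ d)
    {α : ℝ} (hα : 0 < α) (hαd : α < d) :
    ∃ A : ℝ, 0 < A ∧ ∀ (J : Sym2 (Site d) → ℝ) (c : ℝ), 0 < c → (∀ e, 0 ≤ J e) →
      IsTranslationInvariantKernel J → IsIntegrableKernel J → HasPowerLowerBound J c α →
      ∀ β : ℝ, 0 < β → β ≤ kernelCriticalBeta J → ∀ r : ℕ, 1 ≤ r →
        (∑ x ∈ box d r, (kernelPercolation J β).real (openConn (0 : Site d) x)) /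
            ((box d r).card : ℝ) ≤ A / (c * β) * (r : ℝ) ^ (-(d : ℝ) + α) := by
  obtain ⟨A, hA, H⟩ := h d hd α hα hαd
  exact ⟨A, hA, fun J c hc hJ0 hT hI hL β hβ hβc => (H J c hc hJ0 hT hI hL β hβ hβc).1⟩

/-- **Cor. 1.4 alone** (the volume-tail bound on `(0, β_c]`), projected from the fact.
[cite: Hutchcroft2022, Cor. 1.4 (p. 5)] -/
theorem volumeTail (h : Hutchcroft2022_twoPoint_volumeTail) {d : ℕ} (hd : 1 ≤ d)
    {α : ℝ} (hα : 0 < α) (hαd : α < d) :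
    ∃ A : ℝ, 0 < A ∧ ∀ (J : Sym2 (Site d) → ℝ) (c : ℝ), 0 < c → (∀ e, 0 ≤ J e) →
      IsTranslationInvariantKernel J → IsIntegrableKernel J → HasPowerLowerBound J c α →
      ∀ β : ℝ, 0 < β → β ≤ kernelCriticalBeta J → ∀ n : ℕ, 1 ≤ n →
        (kernelPercolation J β).real (clusterSizeGe (0 : Site d) n) ≤
          A / (c * β) ^ ((d : ℝ) / (2 * d - α)) * (n : ℝ) ^ (-((d : ℝ) - α) / (2 * d)) := by
  obtain ⟨A, hA, H⟩ := h d hd α hα hαd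
  exact ⟨A, hA, fun J c hc hJ0 hT hI hL β hβ hβc => (H J c hc hJ0 hT hI hL β hβ hβc).2⟩

/-- **At `β_c` itself** (the printed form of Thm. 1.1 / Cor. 1.4), given `β_c > 0`.
[cite: Hutchcroft2022, Thm. 1.1 (p. 4) and Cor. 1.4 (p. 5)] -/
theorem at_kernelCriticalBeta (h : Hutchcroft2022_twoPoint_volumeTail) {d : ℕ} (hd : 1 ≤ d)
    {α : ℝ} (hα : 0 < α) (hαd : α < d) :
    ∃ A : ℝ, 0 < A ∧ ∀ (J : Sym2 (Site d) → ℝ) (c : ℝ), 0 < c → (∀ e, 0 ≤ J e) →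
      IsTranslationInvariantKernel J → IsIntegrableKernel J → HasPowerLowerBound J c α →
      0 < kernelCriticalBeta J →
        (∀ r : ℕ, 1 ≤ r →
          (∑ x ∈ box d r,
              (kernelPercolation J (kernelCriticalBeta J)).real (openConn (0 : Site d) x)) /
              ((box d r).card : ℝ) ≤
            A / (c * kernelCriticalBeta J) * (r : ℝ) ^ (-(d : ℝ) + α)) ∧
        (∀ n : ℕ, 1 ≤ n →
          (kernelPercolation J (kernelCriticalBeta J)).real (clusterSizeGe (0 : Site d) n) ≤
            A / (c * kernelCriticalBeta J) ^ ((d : ℝ) / (2 * d - α)) *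
              (n : ℝ) ^ (-((d : ℝ) - α) / (2 * d))) := by
  obtain ⟨A, hA, H⟩ := h d hd α hα hαd
  exact ⟨A, hA, fun J c hc hJ0 hT hI hL hβc => H J c hc hJ0 hT hI hL _ hβc le_rfl⟩

/-- **Continuity at `β_c`: `θ_J(β_c) = 0`** — Berger 2002, Thm. 1.5 ("if `{P_k}` is percolating then
it is not critical", for `P_k ∼ β‖k‖₁^{−s}`, `d < s < 2d`; Hutchcroft: "Berger proved in 2002 that
[…] there are no infinite clusters at `β_c` whenever `0 < α < d`"), PROVED for Hutchcroft's class of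
kernels from the fact: if `β_c > 0`, Cor. 1.4 at `β_c` gives
`θ_J(β_c) ≤ ℙ_{β_c}(|K| ≥ n) ≤ C n^{−(d−α)/(2d)} → 0`; if `β_c = 0` (the Lean junk value), `θ_J(0) = 0`.
[cite: Hutchcroft2022, Cor. 1.4 (p. 5) and §1 (p. 3)] [cite: Berger2002, Thm. 1.5] -/
theorem kernelTheta_kernelCriticalBeta_eq_zero (h : Hutchcroft2022_twoPoint_volumeTail) {d : ℕ}
    (hd : 1 ≤ d) {α c : ℝ} (hα : 0 < α) (hαd : α < d) (hc : 0 < c) {J : Sym2 (Site d) → ℝ}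
    (hJ0 : ∀ e, 0 ≤ J e) (hT : IsTranslationInvariantKernel J) (hI : IsIntegrableKernel J)
    (hL : HasPowerLowerBound J c α) : kernelTheta J (kernelCriticalBeta J) = 0 := by
  rcases (kernelCriticalBeta_nonneg J).eq_or_lt with h0 | hpos
  · rw [← h0, kernelTheta_zero]
  obtain ⟨A, hA, H⟩ := h d hd α hα hαd
  obtain ⟨-, hvol⟩ := H J c hc hJ0 hT hI hL _ hpos le_rfl
  set C : ℝ := A / (c * kernelCriticalBeta J) ^ ((d : ℝ) / (2 * d - α)) with hC
  set a : ℝ := ((d : ℝ) - α) / (2 * d) with ha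
  have ha0 : 0 < a := by
    have : (0 : ℝ) < d := by exact_mod_cast hd
    positivity
  -- θ ≤ C n^{-a} for every n ≥ 1
  have hθle : ∀ n : ℕ, 1 ≤ n → kernelTheta J (kernelCriticalBeta J) ≤ C * (n : ℝ) ^ (-a) := by
    intro n hn
    have hmono : kernelTheta J (kernelCriticalBeta J) ≤
        (kernelPercolation J (kernelCriticalBeta J)).real (clusterSizeGe (0 : Site d) n) :=
      measureReal_mono (percolatesAt_subset_clusterSizeGe (0 : Site d) n)
    have := hvol n hn
    rw [neg_div, ← ha] at this
    exact hmono.trans this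
  have hθ0 : 0 ≤ kernelTheta J (kernelCriticalBeta J) := measureReal_nonneg
  by_contra hne
  have hθpos : 0 < kernelTheta J (kernelCriticalBeta J) := lt_of_le_of_ne hθ0 (Ne.symm hne)
  -- C x^{-a} → 0, so eventually C n^{-a} < θ
  have hlim : Filter.Tendsto (fun x : ℝ => C * x ^ (-a)) Filter.atTop (nhds 0) := by
    simpa using (tendsto_rpow_neg_atTop ha0).const_mul C
  obtain ⟨X, hX⟩ := Filter.eventually_atTop.mp (hlim.eventually (gt_mem_nhds hθpos))
  set n : ℕ := max 1 ⌈X⌉₊ with hn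
  have hn1 : 1 ≤ n := le_max_left _ _
  have hnX : X ≤ (n : ℝ) := (Nat.le_ceil X).trans (by exact_mod_cast le_max_right 1 ⌈X⌉₊)
  exact absurd (hθle n hn1) (not_le.mpr (hX n hnX))

end Hutchcroft2022_twoPoint_volumeTail

end Literature.Probability.Percolation

end
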